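import Literature.Computability.MetaComplexity.Frege
import HarnessLib

/-!
# Completeness of the textbook Frege system (discharge of `isFrege_textbookFrege`)

Sibling proof file of `Frege.lean` (D-0014: named facts `def X : Prop` are discharged as
`theorem X_holds : X`). It discharges

* `Literature.CplxMeta.isFrege_textbookFrege_holds : isFrege_textbookFrege` — the concrete system
  `textbookFrege` (Shoenfield's propositional calculus for `¬, ∨`: axiom scheme `¬A ∨ A`,
  rules expansion, contraction, associativity, cut; plus the definitional axiom schemes
  `¬(A ∧ B) ∨ ¬(¬A ∨ ¬B)`, `¬¬(¬A ∨ ¬B) ∨ (A ∧ B)` for the primitive `conj` and the axioms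
  `⊤`, `¬⊥` for the primitive constants) is a Frege system in the sense of Cook–Reckhow: sound
  (`isSound_textbookFrege`, already in `Frege.lean`) and implicationally complete
  (`TextbookFrege.isImplicationallyComplete_textbookFrege`, proved here).

## Sources

* R. E. Hodel, *An Introduction to Mathematical Logic* (PWS 1995; Dover 2013), Ch. 3: p. 100
  (the formal system `P`: axiom `¬A ∨ A`, associative, contraction, expansion and cut rules;
  Def. 1: `A ∧ B` abbreviates `¬(¬A ∨ ¬B)`), p. 101 (Def. 2: proofs using `Γ`; derived rules,
  CM), p. 102 (new expansion, new associative rule, MP, `¬¬`-rules), p. 103 (JOIN, Example 2),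
  p. 112 (GEN EXP, GEN CTN, GEN CUT with their derivations), p. 113 (GEN ASSOC), p. 115
  (Exercise 3(1)–(2): generalized commutative / new associative rules), §3.4 (adequacy
  theorem: `Γ ⊨ A ⇒ Γ ⊢ A`). `P` is Shoenfield's system; Hodel's derivations are followed
  line by line for the derived rules.
* J. R. Shoenfield, *Mathematical Logic* (1967), §2.6 (the propositional axioms and rules),
  §3.1 (the tautology theorem: Lemma 1 `⊢ A ∨ B ⇒ ⊢ B ∨ A`; Lemma 2, rearrangement of
  disjunctions; "every tautology is a theorem" by induction on disjunctions `A₁ ∨ ⋯ ∨ Aₙ`;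
  detachment of hypotheses). Source of `textbookFrege` in `Frege.lean`.
* S. A. Cook, R. A. Reckhow, *The relative efficiency of propositional proof systems*,
  J. Symbolic Logic 44 (1979) 36–50, §2, Def. 2.2 (implicationally complete, Frege system).

## Proof architecture

1. `FregeSystem.Derives.of_mem`, `FregeSystem.Derives.rule`: derivability from hypotheses `Γ`
   (`FregeSystem.Derives`, `Frege.lean`) contains the hypotheses and is closed under the rule
   schemes of the system (concatenate derivations of the premise instances and append the
   conclusion instance) — the formal content of "derived rule of inference" (Hodel, p. 101).
2. `TextbookFrege.ax`, `expan`, `contr`, `assoc`, `cut`, `conjAx₁`, `conjAx₂`, `top`, `negBot`: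
   the nine rule schemes of `textbookFrege` as closure properties of `textbookFrege.Derives Γ`;
   then Hodel's derived rules `comm` (CM), `expan'` (new EXP), `assoc'` (new ASSOC), `mp`,
   `negNeg`, `genExp`, `genCtn`, `genCut`, `genAssoc`, `genComm`, `genAssoc'`, and `removeBot`
   (`A ∨ ⊥ ⊢ A`).
3. List disjunctions `disjList L = A₁ ∨ (A₂ ∨ ⋯ (Aₙ ∨ ⊥))` and the structural lemma `subset`
   (Shoenfield's Lemma 2: if every member of `L` occurs in `L'` then `⋁L ⊢ ⋁L'`), via
   exchange and contraction in context (`exch`, `ctnCtx`, `absorb`, `subsetCtx`).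
4. Head decomposition rules `consDisj`, `consNegNeg`, `consNegDisj`, `consConj`, `consNegConj`
   (the inductive cases of the tautology theorem, the `∧`-cases through the definitional
   axioms), the semantic base case `exists_axiom_of_isTautology` (a tautology made of
   atom-like formulas contains `⊤`, `¬⊥` or a complementary pair), and the induction on the
   weight of `L` (`derives_disjList_of_isTautology`; `conj` nodes weigh `2` so that every
   decomposition decreases the weight).
5. `derives_of_isTautology` (every tautology is derivable), implicational completeness by
   detaching hypotheses from the tautology `¬ψ₁ ∨ (⋯ (¬ψₘ ∨ φ))` with modus ponens
   (`isImplicationallyComplete_textbookFrege`), and `isFrege_textbookFrege_holds`.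

The completeness argument is Shoenfield's (induction over disjunctions of formulas) organised
as a one-sided sequent calculus read through `disjList`; no deduction theorem is needed.
-/

namespace Literature.Computability.MetaComplexity

open _root_.Computability Complexity Complexity.PropForm

namespace FregeSystem

variable {F : FregeSystem} {Γ : Set (PropForm ℕ)}

/-- A hypothesis is derivable (one-line derivation). [Hodel 1995, p. 101, Def. 2] [folklore] -/
theorem Derives.of_mem {φ : PropForm ℕ} (hφ : φ ∈ Γ) : F.Derives Γ φ := by
  refine ⟨[φ], fun k hk => ?_, rfl⟩
  have hk0 : k = 0 := by simpa using hk
  subst hk0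
  exact Or.inl hφ

/-- Finitely many derivable formulas occur together in one derivation (concatenate the
derivations, `IsDerivation.append`). [Hodel 1995, p. 101 (derived rules of inference)]
[folklore] -/
theorem exists_isDerivation_forall_mem :
    ∀ L : List (PropForm ℕ), (∀ p ∈ L, F.Derives Γ p) →
      ∃ π : List (PropForm ℕ), F.IsDerivation Γ π ∧ ∀ p ∈ L, p ∈ π
  | [], _ => ⟨[], isDerivation_nil F Γ, by simp⟩
  | p :: L, h => by
    obtain ⟨π₁, hπ₁, hlast⟩ := h p List.mem_cons_self
    obtain ⟨π₂, hπ₂, hmem⟩ :=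
      exists_isDerivation_forall_mem L fun q hq => h q (List.mem_cons_of_mem _ hq)
    refine ⟨π₁ ++ π₂, hπ₁.append hπ₂, fun q hq => ?_⟩
    rcases List.mem_cons.1 hq with rfl | hq
    · exact List.mem_append_left _ (List.mem_of_getLast? hlast)
    · exact List.mem_append_right _ (hmem q hq)

/-- **Closure of derivability under the rules**: if every premise instance `pσ` of a rule of
`F` is derivable from `Γ`, so is the conclusion instance (append it to a derivation containing
all premise instances). [Hodel 1995, p. 101 (derived rules: "if `Γ ⊢ A₁, …, Γ ⊢ Aₙ` then
`Γ ⊢ B`"); Cook–Reckhow 1979, §2] [folklore] -/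
theorem Derives.rule {r : FregeRule} (hr : r ∈ F.rules) (σ : ℕ → PropForm ℕ)
    (h : ∀ p ∈ r.premises, F.Derives Γ (p.subst σ)) : F.Derives Γ (r.conclusion.subst σ) := by
  obtain ⟨π, hπ, hmem⟩ := exists_isDerivation_forall_mem (r.premises.map (PropForm.subst σ))
    (by simpa using h)
  refine ⟨π ++ [r.conclusion.subst σ], fun k hk => ?_, by simp⟩
  rw [List.length_append, List.length_singleton] at hk
  by_cases hk' : k < π.length
  · rw [List.getElem_append_left hk', List.take_append_of_le_length hk'.le]
    exact hπ k hk'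
  · have hkeq : k = π.length := by omega
    have htake : (π ++ [r.conclusion.subst σ]).take k = π := by
      rw [List.take_append_of_le_length (by omega), hkeq, List.take_length]
    rw [List.getElem_concat_length hkeq, htake]
    exact Or.inr ⟨r, hr, σ, rfl, fun p hp => hmem _ (List.mem_map_of_mem hp)⟩

end FregeSystem

/-! ### The rules of `textbookFrege` and Hodel's derived rules -/

namespace TextbookFrege

/-- The substitution assigning `a, b, c` to the metavariables `0, 1, 2` (and `c` to all
others). [folklore] -/
def sub3 (a b c : PropForm ℕ) : ℕ → PropForm ℕ
  | 0 => a
  | 1 => b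
  | _ => c

variable {Γ : Set (PropForm ℕ)} {a b c d : PropForm ℕ}

/-- Hypotheses are derivable. [Hodel 1995, p. 101, Def. 2] [folklore] -/
theorem hyp (h : a ∈ Γ) : textbookFrege.Derives Γ a :=
  FregeSystem.Derives.of_mem h

/-- Propositional axiom `¬A ∨ A`. [Hodel 1995, p. 100; Shoenfield 1967, §2.6]
[cite: Hodel1995, p. 100] -/
theorem ax (a : PropForm ℕ) : textbookFrege.Derives Γ (disj (neg a) a) :=
  FregeSystem.Derives.rule (F := textbookFrege) (r := ⟨[], disj (neg (var 0)) (var 0)⟩)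
    (by simp [textbookFrege]) (sub3 a a a) (by simp)

/-- Expansion rule `A ⊢ B ∨ A`. [cite: Hodel1995, p. 100] -/
theorem expan (b : PropForm ℕ) (h : textbookFrege.Derives Γ a) :
    textbookFrege.Derives Γ (disj b a) :=
  FregeSystem.Derives.rule (F := textbookFrege) (r := ⟨[var 0], disj (var 1) (var 0)⟩)
    (by simp [textbookFrege]) (sub3 a b b) (by intro p hp; rw [List.mem_singleton] at hp; subst hp; exact h)

/-- Contraction rule `A ∨ A ⊢ A`. [cite: Hodel1995, p. 100] -/
theorem contr (h : textbookFrege.Derives Γ (disj a a)) : textbookFrege.Derives Γ a :=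
  FregeSystem.Derives.rule (F := textbookFrege) (r := ⟨[disj (var 0) (var 0)], var 0⟩)
    (by simp [textbookFrege]) (sub3 a a a) (by intro p hp; rw [List.mem_singleton] at hp; subst hp; exact h)

/-- Associative rule `A ∨ (B ∨ C) ⊢ (A ∨ B) ∨ C`. [cite: Hodel1995, p. 100] -/
theorem assoc (h : textbookFrege.Derives Γ (disj a (disj b c))) :
    textbookFrege.Derives Γ (disj (disj a b) c) :=
  FregeSystem.Derives.rule (F := textbookFrege)
    (r := ⟨[disj (var 0) (disj (var 1) (var 2))], disj (disj (var 0) (var 1)) (var 2)⟩)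
    (by simp [textbookFrege]) (sub3 a b c) (by intro p hp; rw [List.mem_singleton] at hp; subst hp; exact h)

/-- Cut rule `A ∨ B, ¬A ∨ C ⊢ B ∨ C`. [cite: Hodel1995, p. 100] -/
theorem cut (h₁ : textbookFrege.Derives Γ (disj a b))
    (h₂ : textbookFrege.Derives Γ (disj (neg a) c)) : textbookFrege.Derives Γ (disj b c) :=
  FregeSystem.Derives.rule (F := textbookFrege)
    (r := ⟨[disj (var 0) (var 1), disj (neg (var 0)) (var 2)], disj (var 1) (var 2)⟩)
    (by simp [textbookFrege]) (sub3 a b c) (by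
      intro p hp
      simp only [List.mem_cons, List.not_mem_nil, or_false] at hp
      rcases hp with rfl | rfl
      · exact h₁
      · exact h₂)

/-- First definitional axiom for `∧`: `⊢ ¬(A ∧ B) ∨ ¬(¬A ∨ ¬B)`. [Buss 1998, §1.1;
Hodel 1995, p. 100, Def. 1 (`A ∧ B` abbreviates `¬(¬A ∨ ¬B)`)] [cite: Hodel1995, p. 100 Def. 1] -/
theorem conjAx₁ (a b : PropForm ℕ) :
    textbookFrege.Derives Γ (disj (neg (conj a b)) (neg (disj (neg a) (neg b)))) :=
  FregeSystem.Derives.rule (F := textbookFrege)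
    (r := ⟨[], disj (neg (conj (var 0) (var 1))) (neg (disj (neg (var 0)) (neg (var 1))))⟩)
    (by simp [textbookFrege]) (sub3 a b b) (by simp)

/-- Second definitional axiom for `∧`: `⊢ ¬¬(¬A ∨ ¬B) ∨ (A ∧ B)`. [Buss 1998, §1.1;
Hodel 1995, p. 100, Def. 1] [cite: Hodel1995, p. 100 Def. 1] -/
theorem conjAx₂ (a b : PropForm ℕ) :
    textbookFrege.Derives Γ (disj (neg (neg (disj (neg a) (neg b)))) (conj a b)) :=
  FregeSystem.Derives.rule (F := textbookFrege)
    (r := ⟨[], disj (neg (neg (disj (neg (var 0)) (neg (var 1))))) (conj (var 0) (var 1))⟩)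
    (by simp [textbookFrege]) (sub3 a b b) (by simp)

/-- Axiom `⊢ ⊤` for the primitive constant. [Buss 1998, §1.1] [folklore] -/
theorem top : textbookFrege.Derives Γ (const true) :=
  FregeSystem.Derives.rule (F := textbookFrege) (r := ⟨[], const true⟩)
    (by simp [textbookFrege]) (sub3 (const true) (const true) (const true)) (by simp)

/-- Axiom `⊢ ¬⊥` for the primitive constant. [Buss 1998, §1.1] [folklore] -/
theorem negBot : textbookFrege.Derives Γ (neg (const false)) :=
  FregeSystem.Derives.rule (F := textbookFrege) (r := ⟨[], neg (const false)⟩)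
    (by simp [textbookFrege]) (sub3 (const true) (const true) (const true)) (by simp)

/-- Commutative rule `A ∨ B ⊢ B ∨ A` (cut with the axiom). [cite: Hodel1995, p. 101 (CM)] -/
theorem comm (h : textbookFrege.Derives Γ (disj a b)) : textbookFrege.Derives Γ (disj b a) :=
  cut h (ax a)

/-- New expansion rule `A ⊢ A ∨ B`. [cite: Hodel1995, p. 102] -/
theorem expan' (b : PropForm ℕ) (h : textbookFrege.Derives Γ a) :
    textbookFrege.Derives Γ (disj a b) :=
  comm (expan b h)

/-- New associative rule `(A ∨ B) ∨ C ⊢ A ∨ (B ∨ C)`. [cite: Hodel1995, p. 102] -/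
theorem assoc' (h : textbookFrege.Derives Γ (disj (disj a b) c)) :
    textbookFrege.Derives Γ (disj a (disj b c)) :=
  comm (assoc (comm (assoc (comm h))))

/-- Modus ponens `A, ¬A ∨ B ⊢ B`. [cite: Hodel1995, p. 102 (MP)] -/
theorem mp (h₁ : textbookFrege.Derives Γ a) (h₂ : textbookFrege.Derives Γ (disj (neg a) b)) :
    textbookFrege.Derives Γ b :=
  contr (cut (expan' b h₁) h₂)

/-- A `¬¬`-rule: `A ∨ B ⊢ ¬¬A ∨ B`. [cite: Hodel1995, p. 102 (¬¬ rules)] -/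
theorem negNeg (h : textbookFrege.Derives Γ (disj a b)) :
    textbookFrege.Derives Γ (disj (neg (neg a)) b) :=
  comm (cut h (comm (ax (neg a))))

/-- Generalized expansion rule `A ∨ B ⊢ A ∨ (C ∨ B)`. [cite: Hodel1995, p. 112 (GEN EXP)] -/
theorem genExp (c : PropForm ℕ) (h : textbookFrege.Derives Γ (disj a b)) :
    textbookFrege.Derives Γ (disj a (disj c b)) :=
  comm (assoc (expan c (comm h)))

/-- Generalized contraction rule `A ∨ (B ∨ B) ⊢ A ∨ B`. [cite: Hodel1995, p. 112 (GEN CTN)] -/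
theorem genCtn (h : textbookFrege.Derives Γ (disj a (disj b b))) :
    textbookFrege.Derives Γ (disj a b) :=
  contr (assoc (expan a (comm (assoc h))))

/-- Generalized cut rule `A ∨ (B ∨ C), A ∨ (¬B ∨ D) ⊢ A ∨ (C ∨ D)` (Hodel's 17-line
derivation). [cite: Hodel1995, p. 112 (GEN CUT)] -/
theorem genCut (h₁ : textbookFrege.Derives Γ (disj a (disj b c)))
    (h₂ : textbookFrege.Derives Γ (disj a (disj (neg b) d))) :
    textbookFrege.Derives Γ (disj a (disj c d)) := by
  -- (2)–(7): `B ∨ ((C ∨ D) ∨ A)`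
  have h7 : textbookFrege.Derives Γ (disj b (disj (disj c d) a)) :=
    comm (assoc (comm (assoc' (expan' d (assoc h₁)))))
  -- (9)–(14): `¬B ∨ ((C ∨ D) ∨ A)`
  have h14 : textbookFrege.Derives Γ (disj (neg b) (disj (disj c d) a)) :=
    comm (assoc (assoc (expan c (comm (assoc h₂)))))
  -- (15)–(17)
  exact comm (contr (cut h7 h14))

/-- Generalized associative rule `A ∨ (B ∨ (C ∨ D)) ⊢ A ∨ ((B ∨ C) ∨ D)` (Hodel's 16-line
derivation). [cite: Hodel1995, p. 113 (GEN ASSOC)] -/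
theorem genAssoc (h : textbookFrege.Derives Γ (disj a (disj b (disj c d)))) :
    textbookFrege.Derives Γ (disj a (disj (disj b c) d)) := by
  -- (2)–(9): `E ∨ (A ∨ B)` with `E = A ∨ ((B ∨ C) ∨ D)`
  have h9 : textbookFrege.Derives Γ (disj (disj a (disj (disj b c) d)) (disj a b)) :=
    assoc (expan a (assoc (assoc (expan b (assoc' (comm (assoc h)))))))
  -- (10)–(16)
  exact contr (assoc' (assoc' (expan' d (assoc' (expan' c (assoc h9))))))

/-- Generalized commutative rule `A ∨ (B ∨ C) ⊢ A ∨ (C ∨ B)` (generalized cut with the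
axiom). [cite: Hodel1995, p. 115 Exercise 3(1)] -/
theorem genComm (h : textbookFrege.Derives Γ (disj a (disj b c))) :
    textbookFrege.Derives Γ (disj a (disj c b)) :=
  genCut h (expan a (ax b))

/-- Generalized new associative rule `A ∨ ((B ∨ C) ∨ D) ⊢ A ∨ (B ∨ (C ∨ D))`.
[cite: Hodel1995, p. 115 Exercise 3(2)] -/
theorem genAssoc' (h : textbookFrege.Derives Γ (disj a (disj (disj b c) d))) :
    textbookFrege.Derives Γ (disj a (disj b (disj c d))) :=
  genComm (genAssoc (genComm (genAssoc (genComm h))))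

/-- Removing a trailing `⊥`: `A ∨ ⊥ ⊢ A` (cut with `¬⊥`, contraction). [folklore] -/
theorem removeBot (h : textbookFrege.Derives Γ (disj a (const false))) :
    textbookFrege.Derives Γ a :=
  contr (cut (comm h) (comm (expan a negBot)))


/-! ### Disjunctions of lists of formulas: structural rules -/

/-- The right-nested disjunction `A₁ ∨ (A₂ ∨ (⋯ ∨ (Aₙ ∨ ⊥)))` of a list of formulas (the
"sequent" read as a formula). [Shoenfield 1967, §3.1 (`A₁ ∨ ⋯ ∨ Aₙ`); Hodel 1995, §3.3]
[folklore] -/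
def disjList (L : List (PropForm ℕ)) : PropForm ℕ :=
  L.foldr disj (const false)

/-- Unfolding `disjList` on the empty list. [folklore] -/
@[simp] theorem disjList_nil : disjList [] = const false := rfl

/-- Unfolding `disjList` on a nonempty list. [folklore] -/
@[simp] theorem disjList_cons (A : PropForm ℕ) (L : List (PropForm ℕ)) :
    disjList (A :: L) = disj A (disjList L) := rfl

/-- Exchange in context: `X ∨ (A ∨ (B ∨ T)) ⊢ X ∨ (B ∨ (A ∨ T))`.
[cite: Hodel1995, p. 115 Exercise 3(1)–(2)] -/
theorem exch {X A B T : PropForm ℕ}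
    (h : textbookFrege.Derives Γ (disj X (disj A (disj B T)))) :
    textbookFrege.Derives Γ (disj X (disj B (disj A T))) :=
  assoc' (genComm (assoc (genAssoc' (genComm h))))

/-- Contraction in context: `X ∨ (A ∨ (A ∨ T)) ⊢ X ∨ (A ∨ T)`.
[cite: Hodel1995, p. 112 (GEN CTN)] -/
theorem ctnCtx {X A T : PropForm ℕ}
    (h : textbookFrege.Derives Γ (disj X (disj A (disj A T)))) :
    textbookFrege.Derives Γ (disj X (disj A T)) :=
  genComm (assoc' (genCtn (assoc (genComm (genAssoc h)))))

/-- Absorption in context: if `A` occurs in `L` then `X ∨ (A ∨ ⋁L) ⊢ X ∨ ⋁L`.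
[Shoenfield 1967, §3.1, Lemma 2] [folklore] -/
theorem absorb {A : PropForm ℕ} :
    ∀ {L : List (PropForm ℕ)} {X : PropForm ℕ}, A ∈ L →
      textbookFrege.Derives Γ (disj X (disj A (disjList L))) →
      textbookFrege.Derives Γ (disj X (disjList L))
  | [], _, hA, _ => absurd hA List.not_mem_nil
  | B :: L, X, hA, h => by
    rw [disjList_cons] at h ⊢
    by_cases hAB : A = B
    · subst hAB
      exact ctnCtx h
    · have hA' : A ∈ L := (List.mem_cons.1 hA).resolve_left hAB
      exact assoc' (absorb hA' (assoc (exch h)))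

/-- **Structural lemma in context** (weakening, contraction and exchange at once): if every
member of `L` occurs in `L'` then `X ∨ ⋁L ⊢ X ∨ ⋁L'`. [Shoenfield 1967, §3.1, Lemma 2 ("if
`⊢ A_{i₁} ∨ ⋯ ∨ A_{iₘ}` and each `A_{iⱼ}` is among `A₁, …, Aₙ` then `⊢ A₁ ∨ ⋯ ∨ Aₙ`")]
[folklore] -/
theorem subsetCtx :
    ∀ {L L' : List (PropForm ℕ)} {X : PropForm ℕ}, (∀ A ∈ L, A ∈ L') →
      textbookFrege.Derives Γ (disj X (disjList L)) →
      textbookFrege.Derives Γ (disj X (disjList L'))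
  | [], L', X, _, h => expan' _ (removeBot h)
  | A :: L, L', X, hsub, h => by
    rw [disjList_cons] at h
    have ih := subsetCtx (X := disj X A) (fun B hB => hsub B (List.mem_cons_of_mem _ hB))
      (assoc h)
    exact absorb (hsub A List.mem_cons_self) (assoc' ih)

/-- **Structural lemma**: if every member of `L` occurs in `L'` then `⋁L ⊢ ⋁L'`.
[Shoenfield 1967, §3.1, Lemma 2] [folklore] -/
theorem subset {L L' : List (PropForm ℕ)} (hsub : ∀ A ∈ L, A ∈ L')
    (h : textbookFrege.Derives Γ (disjList L)) : textbookFrege.Derives Γ (disjList L') :=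
  removeBot (comm (subsetCtx hsub (expan (const false) h)))

/-- A derivable binary disjunction as a two-element list. [folklore] -/
theorem disjList_pair (h : textbookFrege.Derives Γ (disj a b)) :
    textbookFrege.Derives Γ (disjList [a, b]) :=
  comm (assoc (comm (assoc (expan (const false) h))))

/-! ### Decomposition rules at the head of a list -/

/-- `⋁(B :: C :: L) ⊢ ⋁((B ∨ C) :: L)`. [Shoenfield 1967, §3.1 (proof of the tautology
theorem, case `∨`)] [folklore] -/
theorem consDisj {B C : PropForm ℕ} {L : List (PropForm ℕ)}
    (h : textbookFrege.Derives Γ (disjList (B :: C :: L))) :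
    textbookFrege.Derives Γ (disjList (disj B C :: L)) :=
  assoc h

/-- `⋁(B :: L) ⊢ ⋁(¬¬B :: L)`. [Shoenfield 1967, §3.1 (case `¬¬`); Hodel 1995, p. 102]
[folklore] -/
theorem consNegNeg {B : PropForm ℕ} {L : List (PropForm ℕ)}
    (h : textbookFrege.Derives Γ (disjList (B :: L))) :
    textbookFrege.Derives Γ (disjList (neg (neg B) :: L)) :=
  negNeg h

/-- `⋁(¬B :: L), ⋁(¬C :: L) ⊢ ⋁(¬(B ∨ C) :: L)`. [Shoenfield 1967, §3.1 (case `¬∨`)]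
[folklore] -/
theorem consNegDisj {B C : PropForm ℕ} {L : List (PropForm ℕ)}
    (hB : textbookFrege.Derives Γ (disjList (neg B :: L)))
    (hC : textbookFrege.Derives Γ (disjList (neg C :: L))) :
    textbookFrege.Derives Γ (disjList (neg (disj B C) :: L)) := by
  rw [disjList_cons] at hB hC ⊢
  have h0 : textbookFrege.Derives Γ (disj B (disj C (neg (disj B C)))) :=
    assoc' (comm (ax (disj B C)))
  exact genCtn (assoc' (cut (assoc' (cut h0 hB)) hC))

/-- `⋁(B :: L), ⋁(C :: L) ⊢ ⋁((B ∧ C) :: L)` (via the definitional axiom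
`¬¬(¬B ∨ ¬C) ∨ (B ∧ C)`). [Hodel 1995, p. 103 (JOIN); Buss 1998, §1.1] [folklore] -/
theorem consConj {B C : PropForm ℕ} {L : List (PropForm ℕ)}
    (hB : textbookFrege.Derives Γ (disjList (B :: L)))
    (hC : textbookFrege.Derives Γ (disjList (C :: L))) :
    textbookFrege.Derives Γ (disjList (conj B C :: L)) := by
  have hM := consNegDisj (consNegNeg hB) (consNegNeg hC)
  rw [disjList_cons] at hM ⊢
  exact comm (cut hM (conjAx₂ B C))

/-- `⋁(¬B :: ¬C :: L) ⊢ ⋁(¬(B ∧ C) :: L)` (via the definitional axiom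
`¬(B ∧ C) ∨ ¬(¬B ∨ ¬C)`). [Hodel 1995, p. 103 (Example 2); Buss 1998, §1.1] [folklore] -/
theorem consNegConj {B C : PropForm ℕ} {L : List (PropForm ℕ)}
    (h : textbookFrege.Derives Γ (disjList (neg B :: neg C :: L))) :
    textbookFrege.Derives Γ (disjList (neg (conj B C) :: L)) := by
  simp only [disjList_cons] at h ⊢
  exact comm (cut (assoc h) (comm (conjAx₁ B C)))

/-! ### Semantics of list disjunctions -/

/-- `⋁L` is true under `σ` iff some member of `L` is. [folklore] -/
theorem eval_disjList (σ : ℕ → Bool) (L : List (PropForm ℕ)) :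
    (disjList L).eval σ = true ↔ ∃ A ∈ L, A.eval σ = true := by
  induction L with
  | nil => simp [disjList, eval]
  | cons A L ih => simp [eval, Bool.or_eq_true, ih]

/-- Tautologyhood of `⋁L` only depends on the set of members of `L`. [folklore] -/
theorem isTautology_disjList_of_subset {L L' : List (PropForm ℕ)} (hsub : ∀ A ∈ L, A ∈ L')
    (h : (disjList L).IsTautology) : (disjList L').IsTautology := by
  intro σ
  obtain ⟨A, hA, hAσ⟩ := (eval_disjList σ L).1 (h σ)
  exact (eval_disjList σ L').2 ⟨A, hsub A hA, hAσ⟩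

/-- The atom-like formulas: variables, constants and their negations. [Shoenfield 1967, §3.1
(elementary formulas)] [folklore] -/
def atomLike : PropForm ℕ → Bool
  | var _ => true
  | const _ => true
  | neg (var _) => true
  | neg (const _) => true
  | _ => false

/-- **Axiom case of the completeness induction.** If all members of `L` are atom-like and `⋁L`
is a tautology, then `L` contains `⊤`, or `¬⊥`, or a complementary pair `x`, `¬x` (otherwise
the assignment making exactly the negated variables of `L` true falsifies every member).
[Shoenfield 1967, §3.1 (proof of the tautology theorem, base case)] [folklore] -/
theorem exists_axiom_of_isTautology {L : List (PropForm ℕ)} (hat : ∀ A ∈ L, atomLike A = true)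
    (h : (disjList L).IsTautology) :
    const true ∈ L ∨ neg (const false) ∈ L ∨ ∃ x, var x ∈ L ∧ neg (var x) ∈ L := by
  classical
  by_contra hcon
  simp only [not_or, not_exists, not_and] at hcon
  obtain ⟨h₁, h₂, h₃⟩ := hcon
  set σ : ℕ → Bool := fun x => decide (neg (var x) ∈ L) with hσ
  obtain ⟨A, hA, hAσ⟩ := (eval_disjList σ L).1 (h σ)
  have hatA := hat A hA
  match A, hA, hAσ, hatA with
  | var x, hA, hAσ, _ =>
    have : neg (var x) ∈ L := by simpa [eval, hσ] using hAσ
    exact h₃ x hA this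
  | const b, hA, hAσ, _ =>
    cases b
    · simp [eval] at hAσ
    · exact h₁ hA
  | neg (var x), hA, hAσ, _ =>
    have : neg (var x) ∉ L := by simpa [eval, hσ] using hAσ
    exact this hA
  | neg (const b), hA, hAσ, _ =>
    cases b
    · exact h₂ hA
    · simp [eval] at hAσ
  | neg (neg _), _, _, hatA => simp [atomLike] at hatA
  | neg (conj _ _), _, _, hatA => simp [atomLike] at hatA
  | neg (disj _ _), _, _, hatA => simp [atomLike] at hatA
  | conj _ _, _, _, hatA => simp [atomLike] at hatA
  | disj _ _, _, _, hatA => simp [atomLike] at hatA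

/-! ### The completeness induction -/

/-- The induction measure: node count with conjunctions counted twice (so that replacing
`¬(B ∧ C)` by `¬B, ¬C` decreases it). [folklore] -/
def weight : PropForm ℕ → ℕ
  | var _ => 1
  | const _ => 1
  | neg φ => weight φ + 1
  | conj φ ψ => weight φ + weight ψ + 2
  | disj φ ψ => weight φ + weight ψ + 1

/-- The total weight of a list of formulas. [folklore] -/
def weightL (L : List (PropForm ℕ)) : ℕ :=
  (L.map weight).sum

/-- Unfolding `weightL`. [folklore] -/
@[simp] theorem weightL_nil : weightL [] = 0 := rfl

/-- Unfolding `weightL`. [folklore] -/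
@[simp] theorem weightL_cons (A : PropForm ℕ) (L : List (PropForm ℕ)) :
    weightL (A :: L) = weight A + weightL L := by
  simp [weightL]

/-- Filtering does not increase the total weight. [folklore] -/
theorem weightL_filter_le (p : PropForm ℕ → Bool) (L : List (PropForm ℕ)) :
    weightL (L.filter p) ≤ weightL L := by
  induction L with
  | nil => simp
  | cons A L ih =>
    rw [List.filter_cons]
    split_ifs <;> simp only [weightL_cons] <;> omega

/-- Moving a member `A` of `L` to the front and deleting its other copies does not increase the
total weight. [folklore] -/
theorem weight_add_weightL_filter_le {A : PropForm ℕ} :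
    ∀ {L : List (PropForm ℕ)}, A ∈ L → weight A + weightL (L.filter (· ≠ A)) ≤ weightL L
  | [], hA => absurd hA List.not_mem_nil
  | B :: L, hA => by
    rw [List.filter_cons, weightL_cons]
    by_cases hAB : A = B
    · subst hAB
      rw [if_neg (by simp)]
      have := weightL_filter_le (fun C => decide (C ≠ A)) L
      omega
    · have hA' : A ∈ L := (List.mem_cons.1 hA).resolve_left hAB
      have := weight_add_weightL_filter_le hA'
      rw [if_pos (by simpa using fun h => hAB h.symm), weightL_cons]
      omega

/-- **Inductive step.** If `⋁L` is derivable for every tautology `⋁L` of smaller weight, then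
`⋁(A :: L)` is derivable for every tautology with `A` not atom-like: decompose `A` by the head
rules `consDisj`, `consNegNeg`, `consNegDisj`, `consConj`, `consNegConj`.
[Shoenfield 1967, §3.1 (proof of the tautology theorem, inductive cases)] [folklore] -/
theorem derives_cons_of_lt {n : ℕ}
    (ih : ∀ L : List (PropForm ℕ), weightL L < n → (disjList L).IsTautology →
      textbookFrege.Derives Γ (disjList L))
    (A : PropForm ℕ) (L : List (PropForm ℕ)) (hA : atomLike A = false)
    (hw : weight A + weightL L ≤ n) (ht : (disjList (A :: L)).IsTautology) :
    textbookFrege.Derives Γ (disjList (A :: L)) := by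
  match A, hA, hw, ht with
  | var _, hA, _, _ => simp [atomLike] at hA
  | const _, hA, _, _ => simp [atomLike] at hA
  | neg (var _), hA, _, _ => simp [atomLike] at hA
  | neg (const _), hA, _, _ => simp [atomLike] at hA
  | disj B C, _, hw, ht =>
    refine consDisj (ih _ ?_ fun σ => ?_)
    · simp only [weightL_cons, weight] at hw ⊢; omega
    · have := ht σ; simp only [disjList_cons, eval, Bool.or_eq_true] at this ⊢; tauto
  | neg (neg B), _, hw, ht =>
    refine consNegNeg (ih _ ?_ fun σ => ?_)
    · simp only [weightL_cons, weight] at hw ⊢; omega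
    · have := ht σ; simpa [disjList_cons, eval] using this
  | neg (disj B C), _, hw, ht =>
    refine consNegDisj (ih _ ?_ fun σ => ?_) (ih _ ?_ fun σ => ?_)
    · simp only [weightL_cons, weight] at hw ⊢; omega
    · have := ht σ
      simp only [disjList_cons, eval, Bool.or_eq_true, Bool.not_eq_true',
        Bool.or_eq_false_iff] at this ⊢
      tauto
    · simp only [weightL_cons, weight] at hw ⊢; omega
    · have := ht σ
      simp only [disjList_cons, eval, Bool.or_eq_true, Bool.not_eq_true',
        Bool.or_eq_false_iff] at this ⊢
      tauto
  | conj B C, _, hw, ht =>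
    refine consConj (ih _ ?_ fun σ => ?_) (ih _ ?_ fun σ => ?_)
    · simp only [weightL_cons, weight] at hw ⊢; omega
    · have := ht σ
      simp only [disjList_cons, eval, Bool.or_eq_true, Bool.and_eq_true] at this ⊢
      tauto
    · simp only [weightL_cons, weight] at hw ⊢; omega
    · have := ht σ
      simp only [disjList_cons, eval, Bool.or_eq_true, Bool.and_eq_true] at this ⊢
      tauto
  | neg (conj B C), _, hw, ht =>
    refine consNegConj (ih _ ?_ fun σ => ?_)
    · simp only [weightL_cons, weight] at hw ⊢; omega
    · have := ht σ
      simp only [disjList_cons, eval, Bool.or_eq_true, Bool.not_eq_true',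
        Bool.and_eq_false_iff] at this ⊢
      tauto

/-- **Main lemma (completeness for list disjunctions).** Every tautology of the form `⋁L` is
derivable in `textbookFrege` (from any hypotheses), by induction on the weight of `L`: either
some member is not atom-like (move it to the front, `subset`, and decompose it,
`derives_cons_of_lt`), or `L` contains an axiom `¬x, x` / `⊤` / `¬⊥`
(`exists_axiom_of_isTautology`). [Shoenfield 1967, §3.1 (tautology theorem: "every tautology
is a theorem"); Hodel 1995, §3.4 (adequacy theorem)] [folklore] -/
theorem derives_disjList_of_isTautology :
    ∀ (n : ℕ) (L : List (PropForm ℕ)), weightL L < n → (disjList L).IsTautology →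
      textbookFrege.Derives Γ (disjList L)
  | 0, _, hn, _ => absurd hn (Nat.not_lt_zero _)
  | n + 1, L, hn, ht => by
    classical
    by_cases hex : ∃ A ∈ L, atomLike A = false
    · obtain ⟨A, hAL, hA⟩ := hex
      have hsub₁ : ∀ B ∈ A :: L.filter (· ≠ A), B ∈ L := by
        intro B hB
        rcases List.mem_cons.1 hB with rfl | hB
        · exact hAL
        · exact List.mem_of_mem_filter hB
      have hsub₂ : ∀ B ∈ L, B ∈ A :: L.filter (· ≠ A) := by
        intro B hB
        by_cases hBA : B = A
        · exact hBA ▸ List.mem_cons_self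
        · exact List.mem_cons_of_mem _ (List.mem_filter.2 ⟨hB, by simpa using hBA⟩)
      have hw := weight_add_weightL_filter_le hAL
      exact subset hsub₁ (derives_cons_of_lt (derives_disjList_of_isTautology n) A _ hA
        (by omega) (isTautology_disjList_of_subset hsub₂ ht))
    · have hat : ∀ A ∈ L, atomLike A = true := by
        intro A hA
        by_contra h'
        exact hex ⟨A, hA, by simpa using h'⟩
      rcases exists_axiom_of_isTautology hat ht with htop | hbot | ⟨x, hx, hnx⟩
      · exact subset (L := [const true]) (by simpa using htop) (expan' _ top)
      · exact subset (L := [neg (const false)]) (by simpa using hbot) (expan' _ negBot)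
      · exact subset (L := [neg (var x), var x]) (by simp [hx, hnx]) (disjList_pair (ax (var x)))

/-- **Every tautology is a theorem of `textbookFrege`** (derivable from any set of
hypotheses). [Shoenfield 1967, §3.1 (Corollary to the tautology theorem); Hodel 1995, §3.4,
adequacy theorem (special case `⊨ A ⇒ ⊢ A`)] [cite: Hodel1995, §3.4 (adequacy theorem)] -/
theorem derives_of_isTautology {φ : PropForm ℕ} (h : φ.IsTautology) :
    textbookFrege.Derives Γ φ := by
  refine removeBot (derives_disjList_of_isTautology (weightL [φ] + 1) [φ] (Nat.lt_succ_self _)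
    fun σ => ?_)
  simpa [disjList, eval] using h σ

/-- **Implicational completeness of `textbookFrege`**: if `φ` is a semantic consequence of the
finite set `Γ`, then `Γ ⊢ φ` — prove the tautology `¬ψ₁ ∨ (¬ψ₂ ∨ ⋯ (¬ψₘ ∨ φ))` and detach the
hypotheses `ψᵢ ∈ Γ` by modus ponens. [Shoenfield 1967, §3.1 (tautology theorem: "if `B` is a
tautological consequence of `A₁, …, Aₙ` and `⊢ A₁, …, ⊢ Aₙ` then `⊢ B`"); Hodel 1995, §3.4
(adequacy theorem, `Γ ⊨ A ⇒ Γ ⊢ A`); Cook–Reckhow 1979, §2 (implicationally complete)]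
[cite: Hodel1995, §3.4 (adequacy theorem)] [cite: CookReckhow1979, §2 Def. 2.2] -/
theorem isImplicationallyComplete_textbookFrege : textbookFrege.IsImplicationallyComplete := by
  intro Γ φ h
  have key : ∀ (L : List (PropForm ℕ)), (∀ ψ ∈ L, ψ ∈ Γ) → ∀ φ : PropForm ℕ,
      (∀ σ : ℕ → Bool, (∀ ψ ∈ L, ψ.eval σ = true) → φ.eval σ = true) →
      textbookFrege.Derives (↑Γ) φ := by
    intro L
    induction L with
    | nil =>
      intro _ φ hφ
      exact derives_of_isTautology fun σ => hφ σ (by simp)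
    | cons ψ L ih =>
      intro hL φ hφ
      have h₁ : textbookFrege.Derives (↑Γ) ψ := hyp (hL ψ List.mem_cons_self)
      refine mp h₁ (ih (fun χ hχ => hL χ (List.mem_cons_of_mem _ hχ)) (disj (neg ψ) φ)
        fun σ hσ => ?_)
      cases hψ : ψ.eval σ
      · simp [eval, hψ]
      · have := hφ σ (fun χ hχ => by
          rcases List.mem_cons.1 hχ with rfl | hχ
          · exact hψ
          · exact hσ χ hχ)
        simp [eval, this]
  exact key Γ.toList (fun ψ hψ => Finset.mem_toList.1 hψ) φ
    fun σ hσ => h σ fun ψ hψ => hσ ψ (Finset.mem_toList.2 hψ)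

end TextbookFrege

/-- **Discharge of `isFrege_textbookFrege`**: `textbookFrege` is a Frege system — its rules are
sound (`isSound_textbookFrege`) and it is implicationally complete
(`TextbookFrege.isImplicationallyComplete_textbookFrege`, Shoenfield's tautology theorem for
`¬, ∨` extended by the definitional axioms for `∧` and the constants).
[Shoenfield 1967, §3.1 (tautology theorem); Hodel 1995, §§3.1–3.4 (system `P`, derived rules,
adequacy theorem); Cook–Reckhow 1979, §2] [cite: Hodel1995, §3.4 (adequacy theorem)]
[cite: CookReckhow1979, §2 Def. 2.2] -/
theorem isFrege_textbookFrege_holds : isFrege_textbookFrege :=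
  ⟨isSound_textbookFrege, TextbookFrege.isImplicationallyComplete_textbookFrege⟩

end Literature.Computability.MetaComplexity
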